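import Literature.Probability.RandomPlanarGeometry.SLEImageLocalMartingale
import Literature.Probability.RandomPlanarGeometry.BrownianOscillationTail
import HarnessLib

/-!
# The bracket of the localised image driving function of SLE₆, I: pathwise cell lemmas and tails

G. F. Lawler, O. Schramm, W. Werner, Acta Math. **187** (2001), Thm. 2.2 / [LSW] 2003 §5 (remark
after (5.1)): at `κ = 6` the image driving value `W̃_t = h_t(W_t)` is a continuous local martingale
**with bracket `6 ∫₀ᵗ h_s'(W_s)² ds`**. For the stopped process `Mⁿ = imgMartK 6 hA hne n` and its clock
`imgClockK 6 hA hne n = ∫₀^{· ∧ T} Φ'_{B_s}(0)² ds` (`SLEImageLocalisation`), the compensated square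
`Zⁿ = (Mⁿ)² − 6 · imgClockK` is treated by the conditional-increment scheme of
`SLEImageLocalMartingale`; this file supplies the PATHWISE inputs and the TAIL TOOLS:

* `abs_imgClockK_sub_sub_le` — over a cell `[u, u+h]` from a base `u < T` with small driver
  oscillation, `|(c_{u+h} − c_u) − Φ'_{B_u}(0)² h| ≤ 2h · cellErr + h 𝟙{T < u+h}` (continuity of
  `Φ'` along the path, `abs_starDeriv_add_sub_leK`);
* `indicator_imgBracket_sub_eq`, `abs_imgBracketDefect_le` — the cell decomposition
  `𝟙_S ΔZ = g ((ΔΦ)² − 6 Φ'² h) + 2 g Mⁿ_u ΔΦ + g · defect` (`g = 𝟙_S 𝟙{u < T}`) and the pointwise bound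
  of the defect: `O(h² + κ₀²)` on the boundary event, `12 h · cellErr` on the bulk, and a polynomial in
  the running supremum on the bad event of large oscillation;
* `measureReal_oscFn_incr_ge_le_pow_four`, `integral_indicator_oscFn_mul_runSup_pow_le` — the bad
  event has probability `≤ 768 h⁴/a⁸` (Gaussian tail of the running supremum,
  `measure_le_runSup_le_exp`, and `e^{-y} ≤ 24/y⁴`), whence `E[𝟙_Bad X] = O(h³)`,
  `E[𝟙_Bad X²] = O(h²)` for `X = runSup (u + h)` (fourth moment `integral_runSup_pow_four_le`).

## References

* G. F. Lawler, O. Schramm, W. Werner, Acta Math. **187** (2001), Thm. 2.2. [LawlerSchrammWerner2001]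
* [LSW] 2003, §5 (remark after (5.1)). [LawlerSchrammWerner2003Restriction]
* D. Revuz, M. Yor (1999), Ch. II Prop. (1.8). [RevuzYor1999]
-/

noncomputable section

open Set Filter Metric Function MeasureTheory ProbabilityTheory
open _root_.Complex _root_.Topology
open Literature.Probability.Process (brownian preWienerMeasure runSup)
open Literature.Analysis.FunctionSpaces (timeIntegral trunc)
open scoped NNReal Interval

namespace Literature.Probability.RandomPlanarGeometry

open Loewner PathOps

variable {A : Set ℂ} {hA : IsStarHull A} {hne : A.Nonempty} {n : ℕ}

/-- Off the bad event the `√6`-driver oscillates by at most `κ₀` over the cell. [folklore] -/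
theorem abs_drvK_six_sub_le_of_oscFn_lt {u h : ℝ≥0} {κ₀ : ℝ} {ω : ℝ≥0 → ℝ}
    (hosc : oscFn h (incr u (brownianCPath ω)) < κ₀ / Real.sqrt 6) (r : ℝ≥0) (hr : r ≤ h) :
    |drvK 6 (brownianCPath ω) (u + r) - drvK 6 (brownianCPath ω) u| ≤ κ₀ := by
  have h6 : (0 : ℝ) < Real.sqrt 6 := Real.sqrt_pos.2 (by norm_num)
  have h1' := abs_incr_le_oscFn hr u (brownianCPath ω)
  have : drvK 6 (brownianCPath ω) (u + r) - drvK 6 (brownianCPath ω) u =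
      Real.sqrt 6 * ((brownianCPath ω) (u + r) - (brownianCPath ω) u) := by
    simp only [drvK]; push_cast; ring
  rw [this, abs_mul, abs_of_nonneg h6.le]
  exact ((lt_div_iff₀' h6).1 (lt_of_le_of_lt h1' hosc)).le

/-! ### The clock over a cell -/

section Clock

variable {κ : ℝ≥0} {ω : ℝ≥0 → ℝ} {u h : ℝ≥0} {κ₀ : ℝ}

/-- **The clock increment over a cell is `Φ'_{B_u}(0)² h` up to `2h · cellErr (+ h on the boundary
cell)`**: from a base `u < imgLocTimeK n` with driver oscillation `≤ κ₀` over the cell and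
`stepSize κ₀ h ≤ cₙ (cₙ/16)/1000`. [folklore] -/
theorem abs_imgClockK_sub_sub_le (hu : (u : WithTop ℝ≥0) < imgLocTimeK κ hA hne n ω) (hh0 : 0 < h)
    (hS : ∀ r : ℝ≥0, r ≤ h → |drvK κ (brownianCPath ω) (u + r) - drvK κ (brownianCPath ω) u| ≤ κ₀)
    (hsmall : stepSize κ₀ h ≤ locLevel n * (locLevel n / 16) / 1000) :
    ((((u + h : ℝ≥0) : WithTop ℝ≥0) ≤ imgLocTimeK κ hA hne n ω →
        |(imgClockK κ hA hne n (u + h) ω - imgClockK κ hA hne n u ω) -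
            starDeriv (slidHull (drvK κ (brownianCPath ω)) A u) ^ 2 * h| ≤ 2 * h * cellErr n κ₀ h)) ∧
      |(imgClockK κ hA hne n (u + h) ω - imgClockK κ hA hne n u ω) -
          starDeriv (slidHull (drvK κ (brownianCPath ω)) A u) ^ 2 * h| ≤ 2 * h * cellErr n κ₀ h + h := by
  have h0 : (0 : WithTop ℝ≥0) < imgLocTimeK κ hA hne n ω := lt_of_le_of_lt bot_le hu
  have huT : (u : WithTop ℝ≥0) < locTimeK κ hA hne n ω := lt_of_lt_of_le hu (imgLocTimeK_le_locTimeK n ω)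
  set d : ℝ := starDeriv (slidHull (drvK κ (brownianCPath ω)) A u) with hd
  obtain ⟨hd0, hd1⟩ := starDeriv_pos_le_one (slidHull (drvK κ (brownianCPath ω)) A u)
  set f : ℝ → ℝ := fun r ↦ trunc (imgLocTimeK κ hA hne n) (imgRateK κ hA hne n) r.toNNReal ω with hf
  have hint := intervalIntegrable_trunc_imgRateK (κ := κ) (hA := hA) (hne := hne) n ω
  obtain ⟨hsub, -⟩ := imgClockK_sub_mem (κ := κ) (hA := hA) (hne := hne) (n := n) (le_self_add : u ≤ u + h) ω
  have hce0 : 0 ≤ cellErr n κ₀ h := by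
    have hS0 : 0 ≤ κ₀ := by simpa using hS 0 bot_le
    have := (locLevel_pos_le n).1
    rw [cellErr, stepSize]; positivity
  -- the pointwise bound on `Ι u (u + h)`
  have hpt : ∀ r ∈ Ι (u : ℝ) ((u + h : ℝ≥0) : ℝ), |f r - d ^ 2| ≤ 2 * cellErr n κ₀ h +
      (if (((u + h : ℝ≥0) : WithTop ℝ≥0) ≤ imgLocTimeK κ hA hne n ω) then 0 else 1) := by
    intro r hr
    rw [uIoc_of_le (by exact_mod_cast (le_self_add : u ≤ u + h))] at hr
    have hr0 : 0 ≤ r := u.coe_nonneg.trans hr.1.le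
    have hru : u < r.toNNReal := by rw [← NNReal.coe_lt_coe, Real.coe_toNNReal r hr0]; exact hr.1
    have hruh : r.toNNReal ≤ u + h := by rw [← NNReal.coe_le_coe, Real.coe_toNNReal r hr0]; exact hr.2
    set u' : ℝ≥0 := r.toNNReal - u with hu'
    have hu'0 : 0 < u' := tsub_pos_of_lt hru
    have hreq : r.toNNReal = u + u' := by rw [hu', add_tsub_cancel_of_le hru.le]
    have hu'h : u' ≤ h := by
      have : u + u' ≤ u + h := by rw [← hreq]; exact hruh
      exact le_of_add_le_add_left this
    obtain ⟨-, hdd, -, -⟩ := abs_starDeriv_add_sub_leK (κ := κ) (hA := hA) (hne := hne) (n := n) huT hS hsmall hu'0 hu'h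
    have hsplit0 : 0 ≤ (if (((u + h : ℝ≥0) : WithTop ℝ≥0) ≤ imgLocTimeK κ hA hne n ω) then (0 : ℝ) else 1) := by
      split_ifs <;> norm_num
    by_cases hle : ((r.toNNReal : ℝ≥0) : WithTop ℝ≥0) ≤ imgLocTimeK κ hA hne n ω
    · have hfr : f r = starDeriv (slidHull (drvK κ (brownianCPath ω)) A (u + u')) ^ 2 := by
        rw [hf]; simp only; rw [(trunc_imgRateK_eq_of_le hle h0).1, hreq]
      obtain ⟨he0, he1⟩ := starDeriv_pos_le_one (slidHull (drvK κ (brownianCPath ω)) A (u + u'))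
      rw [hfr, sq_sub_sq, abs_mul]
      have h2 : |starDeriv (slidHull (drvK κ (brownianCPath ω)) A (u + u')) + d| ≤ 2 := by
        rw [abs_of_nonneg (by positivity)]; linarith
      calc _ ≤ 2 * cellErr n κ₀ h := by nlinarith [abs_nonneg (starDeriv (slidHull (drvK κ (brownianCPath ω)) A (u + u')) - d)]
        _ ≤ _ := le_add_of_nonneg_right hsplit0
    · have hfr : f r = 0 := by
        rw [hf]; simp only; rw [Literature.Analysis.FunctionSpaces.trunc_of_not_le hle]
      have hnot : ¬ (((u + h : ℝ≥0) : WithTop ℝ≥0) ≤ imgLocTimeK κ hA hne n ω) := fun h' ↦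
        hle ((WithTop.coe_le_coe.2 hruh).trans h')
      rw [hfr, if_neg hnot, zero_sub, abs_neg, abs_of_nonneg (sq_nonneg _)]
      have : d ^ 2 ≤ 1 := pow_le_one₀ hd0.le hd1
      linarith
  -- integrate
  have hdiff : (imgClockK κ hA hne n (u + h) ω - imgClockK κ hA hne n u ω) - d ^ 2 * h =
      ∫ r in (u : ℝ)..((u + h : ℝ≥0) : ℝ), (f r - d ^ 2) := by
    rw [intervalIntegral.integral_sub (hint (u : ℝ) ((u + h : ℝ≥0) : ℝ)) intervalIntegrable_const, intervalIntegral.integral_const, hsub]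
    simp only [smul_eq_mul]; push_cast; ring
  have key := intervalIntegral.norm_integral_le_of_norm_le_const (a := (u : ℝ)) (b := ((u + h : ℝ≥0) : ℝ))
    (f := fun r ↦ f r - d ^ 2) (C := 2 * cellErr n κ₀ h + (if (((u + h : ℝ≥0) : WithTop ℝ≥0) ≤ imgLocTimeK κ hA hne n ω) then 0 else 1))
    (fun r hr ↦ by rw [Real.norm_eq_abs]; exact hpt r hr)
  rw [Real.norm_eq_abs, ← hdiff] at key
  have habs : |((u + h : ℝ≥0) : ℝ) - u| = h := by push_cast; rw [add_sub_cancel_left, abs_of_nonneg h.coe_nonneg]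
  rw [habs] at key
  constructor
  · intro hle
    rw [if_pos hle, add_zero] at key
    linarith
  · refine key.trans ?_
    split_ifs <;> nlinarith [h.coe_nonneg, hce0]

end Clock

/-! ### The cell decomposition of the compensated square and its defect -/

section Bracket

/-- **The cell decomposition of `Zⁿ = (Mⁿ)² − 6 imgClockK`**: with `g = 𝟙_S 𝟙{u < T}`, `Φ_t = imageDrvFnK 6 A t ∘ β`,
`d = Φ'_{B_u}(0)`,
`𝟙_S ΔZ = g ((ΔΦ)² − 6 d² h) + 2 (g Mⁿ_u) ΔΦ + g [((ΔM)² − (ΔΦ)²) + 2 Mⁿ_u (ΔM − ΔΦ) − 6 (Δc − d² h)]`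
(after `T` both `Mⁿ` and the clock are frozen). [folklore] -/
theorem indicator_imgBracket_sub_eq {κ : ℝ≥0} (S : Set (ℝ≥0 → ℝ)) (u h : ℝ≥0) (ω : ℝ≥0 → ℝ) :
    S.indicator (fun ω ↦ (imgMartK κ hA hne n (u + h) ω ^ 2 - 6 * imgClockK κ hA hne n (u + h) ω) -
        (imgMartK κ hA hne n u ω ^ 2 - 6 * imgClockK κ hA hne n u ω)) ω =
      (S.indicator (fun _ ↦ (1 : ℝ)) ω * {ω | (u : WithTop ℝ≥0) < imgLocTimeK κ hA hne n ω}.indicator (fun _ ↦ (1 : ℝ)) ω) *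
          ((imageDrvFnK κ A (u + h) (brownianCPath ω) - imageDrvFnK κ A u (brownianCPath ω)) ^ 2 -
            6 * starDeriv (slidHull (drvK κ (brownianCPath ω)) A u) ^ 2 * h) +
        2 * ((S.indicator (fun _ ↦ (1 : ℝ)) ω * {ω | (u : WithTop ℝ≥0) < imgLocTimeK κ hA hne n ω}.indicator (fun _ ↦ (1 : ℝ)) ω) *
          imgMartK κ hA hne n u ω) * (imageDrvFnK κ A (u + h) (brownianCPath ω) - imageDrvFnK κ A u (brownianCPath ω)) +
        (S.indicator (fun _ ↦ (1 : ℝ)) ω * {ω | (u : WithTop ℝ≥0) < imgLocTimeK κ hA hne n ω}.indicator (fun _ ↦ (1 : ℝ)) ω) *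
          (((imgMartK κ hA hne n (u + h) ω - imgMartK κ hA hne n u ω) ^ 2 -
              (imageDrvFnK κ A (u + h) (brownianCPath ω) - imageDrvFnK κ A u (brownianCPath ω)) ^ 2) +
            2 * imgMartK κ hA hne n u ω * ((imgMartK κ hA hne n (u + h) ω - imgMartK κ hA hne n u ω) -
              (imageDrvFnK κ A (u + h) (brownianCPath ω) - imageDrvFnK κ A u (brownianCPath ω))) -
            6 * ((imgClockK κ hA hne n (u + h) ω - imgClockK κ hA hne n u ω) -
              starDeriv (slidHull (drvK κ (brownianCPath ω)) A u) ^ 2 * h)) := by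
  by_cases h1 : ω ∈ S
  · rw [Set.indicator_of_mem h1, Set.indicator_of_mem h1]
    by_cases h2 : (u : WithTop ℝ≥0) < imgLocTimeK κ hA hne n ω
    · rw [Set.indicator_of_mem (show ω ∈ {ω | (u : WithTop ℝ≥0) < imgLocTimeK κ hA hne n ω} from h2)]; ring
    · rw [Set.indicator_of_notMem (show ω ∉ {ω | (u : WithTop ℝ≥0) < imgLocTimeK κ hA hne n ω} from h2)]
      obtain ⟨T₀, hT₀⟩ := WithTop.ne_top_iff_exists.1 (imgLocTimeK_ne_top (κ := κ) (hA := hA) (hne := hne) n ω)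
      have hTu : T₀ ≤ u := by
        have := not_lt.1 h2; rw [← hT₀] at this; exact_mod_cast this
      have eM : imgMartK κ hA hne n (u + h) ω = imgMartK κ hA hne n u ω := by
        rw [imgMartK_eq_of_ge hT₀.symm (hTu.trans le_self_add), imgMartK_eq_of_ge hT₀.symm hTu]
      have ec : imgClockK κ hA hne n (u + h) ω = imgClockK κ hA hne n u ω := by
        rw [imgClockK_eq_timeIntegral_min, imgClockK_eq_timeIntegral_min, ← hT₀,
          min_eq_right (by exact_mod_cast (hTu.trans le_self_add) : ((T₀ : ℝ≥0) : WithTop ℝ≥0) ≤ (u + h : ℝ≥0)),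
          min_eq_right (by exact_mod_cast hTu : ((T₀ : ℝ≥0) : WithTop ℝ≥0) ≤ (u : ℝ≥0))]
      rw [eM, ec]; ring
  · rw [Set.indicator_of_notMem h1, Set.indicator_of_notMem h1]; ring

/-- **The defect on the bad event** (large oscillation): the crude bound
`|defect| ≤ (8N₀² + 2Q² + 2N₀Q + 12) + (2N₀M₁ + 4QM₁) X + 2M₁² X²`, `X = runSup (u+h)`. [folklore] -/
theorem abs_imgBracketDefect_le_crude {R : ℝ} (hR0 : 0 < R) (hAR : A ⊆ closedBall (0 : ℂ) R) {u h t₁ : ℝ≥0} (hut : u ≤ t₁)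
    (hh1 : (h : ℝ) ≤ 1) (ω : ℝ≥0 → ℝ) :
    |((imgMartK 6 hA hne n (u + h) ω - imgMartK 6 hA hne n u ω) ^ 2 -
          (imageDrvFnK 6 A (u + h) (brownianCPath ω) - imageDrvFnK 6 A u (brownianCPath ω)) ^ 2) +
        2 * imgMartK 6 hA hne n u ω * ((imgMartK 6 hA hne n (u + h) ω - imgMartK 6 hA hne n u ω) -
          (imageDrvFnK 6 A (u + h) (brownianCPath ω) - imageDrvFnK 6 A u (brownianCPath ω))) -
        6 * ((imgClockK 6 hA hne n (u + h) ω - imgClockK 6 hA hne n u ω) -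
          starDeriv (slidHull (drvK 6 (brownianCPath ω)) A u) ^ 2 * h)| ≤
      (8 * (((n : ℝ) + 1) + 1160 * (3 * ((n : ℝ) + 1) + 13 * Real.sqrt ((n : ℝ) + 1) + R)) ^ 2 + 2 * (15080 * Real.sqrt ((t₁ : ℝ) + 1) + 1160 * R) ^ 2 + 2 * (((n : ℝ) + 1) + 1160 * (3 * ((n : ℝ) + 1) + 13 * Real.sqrt ((n : ℝ) + 1) + R)) * (15080 * Real.sqrt ((t₁ : ℝ) + 1) + 1160 * R) + 12) +
        (2 * (((n : ℝ) + 1) + 1160 * (3 * ((n : ℝ) + 1) + 13 * Real.sqrt ((n : ℝ) + 1) + R)) * (3482 * Real.sqrt 6) + 4 * (15080 * Real.sqrt ((t₁ : ℝ) + 1) + 1160 * R) * (3482 * Real.sqrt 6)) * runSup (u + h) ω +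
        2 * (3482 * Real.sqrt 6) ^ 2 * runSup (u + h) ω ^ 2 := by
  set N₀ : ℝ := (((n : ℝ) + 1) + 1160 * (3 * ((n : ℝ) + 1) + 13 * Real.sqrt ((n : ℝ) + 1) + R)) with hN₀
  set Q : ℝ := (15080 * Real.sqrt ((t₁ : ℝ) + 1) + 1160 * R) with hQ
  set M₁ : ℝ := (3482 * Real.sqrt 6) with hM₁
  set X : ℝ := runSup (u + h) ω with hX
  set ΔM : ℝ := imgMartK 6 hA hne n (u + h) ω - imgMartK 6 hA hne n u ω with hΔM
  set ΔΦ : ℝ := imageDrvFnK 6 A (u + h) (brownianCPath ω) - imageDrvFnK 6 A u (brownianCPath ω) with hΔΦ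
  set Mu : ℝ := imgMartK 6 hA hne n u ω with hMu
  set Δc : ℝ := (imgClockK 6 hA hne n (u + h) ω - imgClockK 6 hA hne n u ω) -
    starDeriv (slidHull (drvK 6 (brownianCPath ω)) A u) ^ 2 * h with hΔc
  have hX0 : 0 ≤ X := Process.runSup_nonneg _ ω
  have hN₀0 : 0 ≤ N₀ := by positivity
  have hQ0 : 0 ≤ Q := by positivity
  have hM₁0 : 0 ≤ M₁ := by positivity
  have hMu : |Mu| ≤ N₀ := abs_imgMartK_le (κ := 6) (hA := hA) (hne := hne) (n := n) hR0 hAR u ω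
  have hΔMle : |ΔM| ≤ 2 * N₀ := by
    calc _ ≤ |imgMartK 6 hA hne n (u + h) ω| + |imgMartK 6 hA hne n u ω| := abs_sub _ _
      _ ≤ N₀ + N₀ := add_le_add (abs_imgMartK_le (κ := 6) hR0 hAR (u + h) ω) hMu
      _ = 2 * N₀ := by ring
  have hΔΦle : |ΔΦ| ≤ M₁ * X + Q := by
    have := abs_imageDrvFnK_brownianCPath_sub_le hA hR0 hAR u h ω
    have hsq : Real.sqrt ((u + h : ℝ≥0) : ℝ) ≤ Real.sqrt ((t₁ : ℝ) + 1) :=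
      Real.sqrt_le_sqrt (by push_cast; exact add_le_add (by exact_mod_cast hut) hh1)
    rw [hΔΦ, hM₁, hX, hQ]
    linarith [mul_le_mul_of_nonneg_left hsq (by norm_num : (0 : ℝ) ≤ 15080)]
  have hΔc : |Δc| ≤ 2 := by
    obtain ⟨-, hcm⟩ := imgClockK_sub_mem (κ := 6) (hA := hA) (hne := hne) (n := n) (le_self_add : u ≤ u + h) ω
    obtain ⟨hd0, hd1⟩ := starDeriv_pos_le_one (slidHull (drvK 6 (brownianCPath ω)) A u)
    have hd2 : starDeriv (slidHull (drvK 6 (brownianCPath ω)) A u) ^ 2 * h ≤ h :=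
      (mul_le_of_le_one_left h.coe_nonneg (pow_le_one₀ hd0.le hd1))
    have hd2' : 0 ≤ starDeriv (slidHull (drvK 6 (brownianCPath ω)) A u) ^ 2 * h := by positivity
    have hcm' : imgClockK 6 hA hne n (u + h) ω - imgClockK 6 hA hne n u ω ≤ h := by
      have := hcm.2; push_cast at this; linarith
    rw [hΔc, abs_le]; constructor <;> linarith [hcm.1]
  have e1 : |ΔM ^ 2 - ΔΦ ^ 2| ≤ 4 * N₀ ^ 2 + 2 * M₁ ^ 2 * X ^ 2 + 2 * Q ^ 2 := by
    have a1 : ΔM ^ 2 ≤ (2 * N₀) ^ 2 := by rw [← sq_abs]; exact pow_le_pow_left₀ (abs_nonneg _) hΔMle 2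
    have a2 : ΔΦ ^ 2 ≤ (M₁ * X + Q) ^ 2 := by rw [← sq_abs]; exact pow_le_pow_left₀ (abs_nonneg _) hΔΦle 2
    have a3 : (M₁ * X + Q) ^ 2 ≤ 2 * M₁ ^ 2 * X ^ 2 + 2 * Q ^ 2 := by nlinarith [sq_nonneg (M₁ * X - Q)]
    calc |ΔM ^ 2 - ΔΦ ^ 2| ≤ |ΔM ^ 2| + |ΔΦ ^ 2| := abs_sub _ _
      _ = ΔM ^ 2 + ΔΦ ^ 2 := by rw [abs_of_nonneg (sq_nonneg _), abs_of_nonneg (sq_nonneg _)]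
      _ ≤ _ := by linarith
  have e2 : |2 * Mu * (ΔM - ΔΦ)| ≤ 2 * N₀ * (2 * N₀ + (M₁ * X + Q)) := by
    rw [abs_mul, abs_mul, abs_two]
    have : |ΔM - ΔΦ| ≤ 2 * N₀ + (M₁ * X + Q) := (abs_sub _ _).trans (add_le_add hΔMle hΔΦle)
    have h2Mu : 2 * |Mu| ≤ 2 * N₀ := by linarith
    exact mul_le_mul h2Mu this (abs_nonneg _) (by positivity)
  have e3 : |6 * Δc| ≤ 12 := by rw [abs_mul]; norm_num; linarith
  calc |ΔM ^ 2 - ΔΦ ^ 2 + 2 * Mu * (ΔM - ΔΦ) - 6 * Δc|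
      ≤ |ΔM ^ 2 - ΔΦ ^ 2| + |2 * Mu * (ΔM - ΔΦ)| + |6 * Δc| := by
        refine (abs_sub _ _).trans (add_le_add (abs_add_le _ _) le_rfl)
    _ ≤ (4 * N₀ ^ 2 + 2 * M₁ ^ 2 * X ^ 2 + 2 * Q ^ 2) + 2 * N₀ * (2 * N₀ + (M₁ * X + Q)) + 12 := add_le_add (add_le_add e1 e2) e3
    _ = (8 * N₀ ^ 2 + 2 * Q ^ 2 + 2 * N₀ * Q + 12) + (2 * N₀ * M₁) * X + 2 * M₁ ^ 2 * X ^ 2 := by ring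
    _ ≤ _ := by nlinarith [mul_nonneg (mul_nonneg hQ0 hM₁0) hX0]

/-- **The defect off the bad event** (small oscillation, `stepSize κ₀ h ≤ cₙ (cₙ/16)/1000`), on `{u < T}`:
`|defect| ≤ 12 h cellErr` on the bulk cells (`T ≥ u + h`: then `ΔM = ΔΦ`) and
`|defect| ≤ D² + 2N₀D + 6h + 12 h cellErr` on the boundary cell (`D = 50h/(cₙ/16) + 4κ₀`). [folklore] -/
theorem abs_imgBracketDefect_le_good {R : ℝ} (hR0 : 0 < R) (hAR : A ⊆ closedBall (0 : ℂ) R) {u h : ℝ≥0} (hh0 : 0 < h)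
    {κ₀ : ℝ} (hh2 : stepSize κ₀ h ≤ locLevel n * (locLevel n / 16) / 1000) {ω : ℝ≥0 → ℝ}
    (hu : (u : WithTop ℝ≥0) < imgLocTimeK 6 hA hne n ω) (hosc : oscFn h (incr u (brownianCPath ω)) < κ₀ / Real.sqrt 6) :
    ((((u + h : ℝ≥0) : WithTop ℝ≥0) ≤ imgLocTimeK 6 hA hne n ω → |((imgMartK 6 hA hne n (u + h) ω - imgMartK 6 hA hne n u ω) ^ 2 -
          (imageDrvFnK 6 A (u + h) (brownianCPath ω) - imageDrvFnK 6 A u (brownianCPath ω)) ^ 2) +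
        2 * imgMartK 6 hA hne n u ω * ((imgMartK 6 hA hne n (u + h) ω - imgMartK 6 hA hne n u ω) -
          (imageDrvFnK 6 A (u + h) (brownianCPath ω) - imageDrvFnK 6 A u (brownianCPath ω))) -
        6 * ((imgClockK 6 hA hne n (u + h) ω - imgClockK 6 hA hne n u ω) -
          starDeriv (slidHull (drvK 6 (brownianCPath ω)) A u) ^ 2 * h)| ≤ 12 * h * cellErr n κ₀ h)) ∧
      |((imgMartK 6 hA hne n (u + h) ω - imgMartK 6 hA hne n u ω) ^ 2 -
          (imageDrvFnK 6 A (u + h) (brownianCPath ω) - imageDrvFnK 6 A u (brownianCPath ω)) ^ 2) +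
        2 * imgMartK 6 hA hne n u ω * ((imgMartK 6 hA hne n (u + h) ω - imgMartK 6 hA hne n u ω) -
          (imageDrvFnK 6 A (u + h) (brownianCPath ω) - imageDrvFnK 6 A u (brownianCPath ω))) -
        6 * ((imgClockK 6 hA hne n (u + h) ω - imgClockK 6 hA hne n u ω) -
          starDeriv (slidHull (drvK 6 (brownianCPath ω)) A u) ^ 2 * h)| ≤ ((50 * (h : ℝ) / (locLevel n / 16) + 4 * κ₀) ^ 2 + 2 * (((n : ℝ) + 1) + 1160 * (3 * ((n : ℝ) + 1) + 13 * Real.sqrt ((n : ℝ) + 1) + R)) * (50 * (h : ℝ) / (locLevel n / 16) + 4 * κ₀) + 6 * h) + 12 * h * cellErr n κ₀ h := by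
  set N₀ : ℝ := (((n : ℝ) + 1) + 1160 * (3 * ((n : ℝ) + 1) + 13 * Real.sqrt ((n : ℝ) + 1) + R)) with hN₀
  set D : ℝ := (50 * (h : ℝ) / (locLevel n / 16) + 4 * κ₀) with hD
  set ΔM : ℝ := imgMartK 6 hA hne n (u + h) ω - imgMartK 6 hA hne n u ω with hΔM
  set ΔΦ : ℝ := imageDrvFnK 6 A (u + h) (brownianCPath ω) - imageDrvFnK 6 A u (brownianCPath ω) with hΔΦ
  set Mu : ℝ := imgMartK 6 hA hne n u ω with hMu
  set Δc : ℝ := (imgClockK 6 hA hne n (u + h) ω - imgClockK 6 hA hne n u ω) -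
    starDeriv (slidHull (drvK 6 (brownianCPath ω)) A u) ^ 2 * h with hΔc
  have hc0 := (locLevel_pos_le n).1
  have hS' : ∀ r : ℝ≥0, r ≤ h → |drvK 6 (brownianCPath ω) (u + r) - drvK 6 (brownianCPath ω) u| ≤ κ₀ :=
    abs_drvK_six_sub_le_of_oscFn_lt hosc
  have hκ₀0 : 0 ≤ κ₀ := by simpa using hS' 0 bot_le
  have hD0 : 0 ≤ D := by positivity
  have hN₀0 : 0 ≤ N₀ := by positivity
  have hce0 : 0 ≤ cellErr n κ₀ h := by rw [cellErr, stepSize]; positivity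
  have hMuN : |Mu| ≤ N₀ := abs_imgMartK_le (κ := 6) (hA := hA) (hne := hne) (n := n) hR0 hAR u ω
  obtain ⟨hz, hbd⟩ := abs_imgMartK_sub_sub_le (κ := 6) hu hh0 hS' hh2
  obtain ⟨hcz, hcb⟩ := abs_imgClockK_sub_sub_le (κ := 6) hu hh0 hS' hh2
  have h0 : (0 : WithTop ℝ≥0) < imgLocTimeK 6 hA hne n ω := lt_of_le_of_lt bot_le hu
  -- the bulk case
  have hbulk : (((u + h : ℝ≥0) : WithTop ℝ≥0) ≤ imgLocTimeK 6 hA hne n ω) →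
      |ΔM ^ 2 - ΔΦ ^ 2 + 2 * Mu * (ΔM - ΔΦ) - 6 * Δc| ≤ 12 * h * cellErr n κ₀ h := fun hle ↦ by
    have hMΦ : ΔM = ΔΦ := sub_eq_zero.1 (hz hle)
    have hval : ΔM ^ 2 - ΔΦ ^ 2 + 2 * Mu * (ΔM - ΔΦ) - 6 * Δc = -(6 * Δc) := by rw [hMΦ]; ring
    rw [hval, abs_neg, abs_mul, show |(6 : ℝ)| = 6 by norm_num]
    have := hcz hle
    linarith
  refine ⟨hbulk, ?_⟩
  rcases le_or_gt (((u + h : ℝ≥0) : WithTop ℝ≥0)) (imgLocTimeK 6 hA hne n ω) with hle | hlt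
  · refine (hbulk hle).trans ?_
    have : 0 ≤ D ^ 2 + 2 * N₀ * D + 6 * (h : ℝ) := by positivity
    linarith
  · -- boundary cell: `|ΔM| ≤ D/2`, `|ΔΦ| ≤ D/2`
    obtain ⟨T₀, hT₀⟩ := WithTop.ne_top_iff_exists.1 (imgLocTimeK_ne_top (κ := 6) (hA := hA) (hne := hne) n ω)
    have huT : u < T₀ := by have := hu; rw [← hT₀] at this; exact_mod_cast this
    have hTuh : T₀ < u + h := by have := hlt; rw [← hT₀] at this; exact_mod_cast this
    set u' : ℝ≥0 := T₀ - u with hu'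
    have hu'0 : 0 < u' := tsub_pos_of_lt huT
    have hTeq : T₀ = u + u' := by rw [hu', add_tsub_cancel_of_le huT.le]
    have hu'h : u' ≤ h := by
      have : u + u' ≤ u + h := by rw [← hTeq]; exact hTuh.le
      exact le_of_add_le_add_left this
    have hMT : imgMartK 6 hA hne n (u + h) ω = imageDriver (drvK 6 (brownianCPath ω)) A (u + u') := by
      rw [imgMartK_eq_of_ge hT₀.symm hTuh.le, hTeq]
      exact (imgDrvP_eq_of_le (t := u + u') (by rw [← hTeq, hT₀]) h0).2.2
    have hMu' : imgMartK 6 hA hne n u ω = imageDriver (drvK 6 (brownianCPath ω)) A u := by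
      rw [imgMartK_eq_of_le hu.le]; exact (imgDrvP_eq_of_le hu.le h0).2.2
    obtain ⟨-, e1⟩ := abs_imageDriver_sub_le_of_lt_imgLocTimeK (κ := 6) hu hS' hh2 hu'0 hu'h
    obtain ⟨halive, e2⟩ := abs_imageDriver_sub_le_of_lt_imgLocTimeK (κ := 6) hu hS' hh2 hh0 le_rfl
    have halive_u := (imgDrvP_eq_of_le hu.le h0).1
    have hD2 : 25 * (h : ℝ) / (locLevel n / 16) + 2 * κ₀ = D / 2 := by rw [hD]; ring
    have hΔM' : |ΔM| ≤ D / 2 := by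
      rw [hΔM, hMu, hMT, hMu', ← hD2]; exact e1
    have hΔΦ' : |ΔΦ| ≤ D / 2 := by
      have : ΔΦ = imageDriver (drvK 6 (brownianCPath ω)) A (u + h) - imageDriver (drvK 6 (brownianCPath ω)) A u := by
        rw [hΔΦ, imageDrvFnK_of_alive halive, imageDrvFnK_of_alive halive_u, imageDriver, imageDriver]; ring
      rw [this, ← hD2]; exact e2
    have f1 : |ΔM ^ 2 - ΔΦ ^ 2| ≤ D ^ 2 := by
      rw [sq_sub_sq, abs_mul]
      have a : |ΔM + ΔΦ| ≤ D := (abs_add_le _ _).trans (by linarith)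
      have b : |ΔM - ΔΦ| ≤ D := hbd
      calc _ ≤ D * D := mul_le_mul a b (abs_nonneg _) hD0
        _ = D ^ 2 := by ring
    have f2 : |2 * Mu * (ΔM - ΔΦ)| ≤ 2 * N₀ * D := by
      rw [abs_mul, abs_mul, abs_two]
      exact mul_le_mul (by linarith) hbd (abs_nonneg _) (by positivity)
    have f3 : |6 * Δc| ≤ 6 * (2 * h * cellErr n κ₀ h + h) := by
      rw [abs_mul, show |(6 : ℝ)| = 6 by norm_num]; exact mul_le_mul_of_nonneg_left hcb (by norm_num)
    calc |ΔM ^ 2 - ΔΦ ^ 2 + 2 * Mu * (ΔM - ΔΦ) - 6 * Δc|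
        ≤ |ΔM ^ 2 - ΔΦ ^ 2| + |2 * Mu * (ΔM - ΔΦ)| + |6 * Δc| :=
          (abs_sub _ _).trans (add_le_add (abs_add_le _ _) le_rfl)
      _ ≤ D ^ 2 + 2 * N₀ * D + 6 * (2 * h * cellErr n κ₀ h + h) := add_le_add (add_le_add f1 f2) f3
      _ = _ := by ring

/-- **The defect of the compensated square, pointwise** (the cases combined). On `{u < T}`, with
`A ⊆ B̄(0, R)`, `u ≤ t₁`, `h ≤ 1`, `stepSize κ₀ h ≤ cₙ (cₙ/16)/1000`, `Bad = {κ₀/√6 ≤ osc_h(incr_u β)}`,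
`E = {u < T < u+h}`, `D = 50h/(cₙ/16) + 4κ₀`, `N₀` the bound of `Mⁿ`, `Q = 15080√(t₁+1) + 1160R`, `M₁ = 3482√6`,
`X = runSup (u+h)`:
`|defect| ≤ 𝟙_E (D² + 2 N₀ D + 6h) + 12 h cellErr + 𝟙_Bad (8N₀² + 2Q² + 2N₀Q + 12) + 𝟙_Bad X (2N₀M₁ + 4 Q M₁) + 𝟙_Bad X² (2M₁²)`.
[folklore] -/
theorem abs_imgBracketDefect_le {R : ℝ} (hR0 : 0 < R) (hAR : A ⊆ closedBall (0 : ℂ) R) {u h t₁ : ℝ≥0} (hut : u ≤ t₁)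
    (hh0 : 0 < h) (hh1 : (h : ℝ) ≤ 1) {κ₀ : ℝ} (hκ₀ : 0 < κ₀) (hh2 : stepSize κ₀ h ≤ locLevel n * (locLevel n / 16) / 1000)
    {ω : ℝ≥0 → ℝ} (hu : (u : WithTop ℝ≥0) < imgLocTimeK 6 hA hne n ω) :
    |((imgMartK 6 hA hne n (u + h) ω - imgMartK 6 hA hne n u ω) ^ 2 -
          (imageDrvFnK 6 A (u + h) (brownianCPath ω) - imageDrvFnK 6 A u (brownianCPath ω)) ^ 2) +
        2 * imgMartK 6 hA hne n u ω * ((imgMartK 6 hA hne n (u + h) ω - imgMartK 6 hA hne n u ω) -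
          (imageDrvFnK 6 A (u + h) (brownianCPath ω) - imageDrvFnK 6 A u (brownianCPath ω))) -
        6 * ((imgClockK 6 hA hne n (u + h) ω - imgClockK 6 hA hne n u ω) -
          starDeriv (slidHull (drvK 6 (brownianCPath ω)) A u) ^ 2 * h)| ≤
      {ω | (u : WithTop ℝ≥0) < imgLocTimeK 6 hA hne n ω ∧ imgLocTimeK 6 hA hne n ω < ((u + h : ℝ≥0) : WithTop ℝ≥0)}.indicator
          (fun _ ↦ (50 * (h : ℝ) / (locLevel n / 16) + 4 * κ₀) ^ 2 + 2 * (((n : ℝ) + 1) + 1160 * (3 * ((n : ℝ) + 1) + 13 * Real.sqrt ((n : ℝ) + 1) + R)) * (50 * (h : ℝ) / (locLevel n / 16) + 4 * κ₀) + 6 * (h : ℝ)) ω +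
        12 * h * cellErr n κ₀ h +
        (8 * (((n : ℝ) + 1) + 1160 * (3 * ((n : ℝ) + 1) + 13 * Real.sqrt ((n : ℝ) + 1) + R)) ^ 2 + 2 * (15080 * Real.sqrt ((t₁ : ℝ) + 1) + 1160 * R) ^ 2 + 2 * (((n : ℝ) + 1) + 1160 * (3 * ((n : ℝ) + 1) + 13 * Real.sqrt ((n : ℝ) + 1) + R)) * (15080 * Real.sqrt ((t₁ : ℝ) + 1) + 1160 * R) + 12) *
          {ω | κ₀ / Real.sqrt 6 ≤ oscFn h (incr u (brownianCPath ω))}.indicator (fun _ ↦ (1 : ℝ)) ω +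
        (2 * (((n : ℝ) + 1) + 1160 * (3 * ((n : ℝ) + 1) + 13 * Real.sqrt ((n : ℝ) + 1) + R)) * (3482 * Real.sqrt 6) + 4 * (15080 * Real.sqrt ((t₁ : ℝ) + 1) + 1160 * R) * (3482 * Real.sqrt 6)) *
          ({ω | κ₀ / Real.sqrt 6 ≤ oscFn h (incr u (brownianCPath ω))}.indicator (fun _ ↦ (1 : ℝ)) ω * runSup (u + h) ω) +
        2 * (3482 * Real.sqrt 6) ^ 2 *
          ({ω | κ₀ / Real.sqrt 6 ≤ oscFn h (incr u (brownianCPath ω))}.indicator (fun _ ↦ (1 : ℝ)) ω * runSup (u + h) ω ^ 2) := by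
  have hc0 := (locLevel_pos_le n).1
  have hX0 : 0 ≤ runSup (u + h) ω := Process.runSup_nonneg _ ω
  have hN₀0 : 0 ≤ (((n : ℝ) + 1) + 1160 * (3 * ((n : ℝ) + 1) + 13 * Real.sqrt ((n : ℝ) + 1) + R)) := by positivity
  have hQ0 : 0 ≤ (15080 * Real.sqrt ((t₁ : ℝ) + 1) + 1160 * R) := by positivity
  have hce0 : 0 ≤ cellErr n κ₀ h := by rw [cellErr, stepSize]; positivity
  have hEv0 : 0 ≤ (50 * (h : ℝ) / (locLevel n / 16) + 4 * κ₀) ^ 2 + 2 * (((n : ℝ) + 1) + 1160 * (3 * ((n : ℝ) + 1) + 13 * Real.sqrt ((n : ℝ) + 1) + R)) * (50 * (h : ℝ) / (locLevel n / 16) + 4 * κ₀) + 6 * (h : ℝ) := by positivity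
  have hE0 := Set.indicator_nonneg (fun _ _ ↦ hEv0)
    (s := {ω | (u : WithTop ℝ≥0) < imgLocTimeK 6 hA hne n ω ∧ imgLocTimeK 6 hA hne n ω < ((u + h : ℝ≥0) : WithTop ℝ≥0)}) ω
  by_cases hbad : ω ∈ {ω | κ₀ / Real.sqrt 6 ≤ oscFn h (incr u (brownianCPath ω))}
  · rw [Set.indicator_of_mem hbad, mul_one, one_mul, one_mul]
    have key := abs_imgBracketDefect_le_crude (hA := hA) (hne := hne) (n := n) hR0 hAR hut hh1 ω
    have t1 : 0 ≤ 12 * (h : ℝ) * cellErr n κ₀ h := by positivity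
    linarith
  · rw [Set.indicator_of_notMem hbad, mul_zero, zero_mul, zero_mul, mul_zero, mul_zero, add_zero, add_zero, add_zero]
    have hosc : oscFn h (incr u (brownianCPath ω)) < κ₀ / Real.sqrt 6 := not_le.1 hbad
    obtain ⟨hbulk, hbdry⟩ := abs_imgBracketDefect_le_good (hA := hA) (hne := hne) (n := n) hR0 hAR hh0 hh2 hu hosc
    rcases le_or_gt (((u + h : ℝ≥0) : WithTop ℝ≥0)) (imgLocTimeK 6 hA hne n ω) with hle | hlt
    · have := hbulk hle
      linarith
    · rw [Set.indicator_of_mem (show ω ∈ {ω | (u : WithTop ℝ≥0) < imgLocTimeK 6 hA hne n ω ∧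
        imgLocTimeK 6 hA hne n ω < ((u + h : ℝ≥0) : WithTop ℝ≥0)} from ⟨hu, hlt⟩)]
      exact hbdry

end Bracket

end Literature.Probability.RandomPlanarGeometry

end
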